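import Summits.HodgeConjecture.HodgeCM.Model.Toy.EigenBasis_1

/-! PORT of `HodgeCM/Model/Toy/EigenBasis.lean` (HodgeCMPerL run 82) — part 2: continuation of `Summits.HodgeConjecture.HodgeCM.Model.Toy.EigenBasis_1` (split at a top-level declaration boundary by port_pkg.py; scope re-opened below; declarations unchanged). -/

-- port_pkg: scope re-opened for this part (file-level context, then the namespace/section stack open at the cut)
namespace HodgeCM.Toy
open scoped TensorProduct
open exteriorPower Module
open Literature.AlgebraicGeometry.Motives
noncomputable section
namespace Obj
variable (X : Obj)
/-- **Complex conjugation of eigen-monomials**: `conj Θ⁻¹(e_g) = Θ⁻¹(e_{ḡ})`. -/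
lemma conj_theta_symm_mono (k : ℕ) (g : Fin k → X.Idx) :
    HodgeStructure.conj ((X.Θ k).symm (X.mono k g)) = (X.Θ k).symm (X.mono k (X.bar ∘ g)) := by
  rw [theta_symm_mono, theta_symm_mono, map_sum]
  refine Finset.sum_congr rfl fun M _ => ?_
  rw [HodgeStructure.conj_tmul, map_prod]
  rfl

/-- conjugation of spans -/
lemma complexConj_span {V : Type*} [AddCommGroup V] [Module ℚ V] (S : Set (ℂ ⊗[ℚ] V)) :
    HodgeStructure.complexConj (Submodule.span ℂ S) = Submodule.span ℂ (HodgeStructure.conj '' S) := by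
  have key : ∀ (T : Set (ℂ ⊗[ℚ] V)) (y : ℂ ⊗[ℚ] V), y ∈ Submodule.span ℂ T →
      HodgeStructure.conj y ∈ Submodule.span ℂ (HodgeStructure.conj '' T) := by
    intro T y hy
    induction hy using Submodule.span_induction with
    | mem x hx => exact Submodule.subset_span ⟨x, hx, rfl⟩
    | zero => simp
    | add x y _ _ hx hy => rw [map_add]; exact Submodule.add_mem _ hx hy
    | smul c x _ hx => rw [HodgeStructure.conj_smul]; exact Submodule.smul_mem _ _ hx
  apply le_antisymm
  · intro x hx
    rw [HodgeStructure.mem_complexConj] at hx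
    have := key S _ hx
    rwa [HodgeStructure.conj_conj] at this
  · rw [Submodule.span_le]
    rintro _ ⟨x, hx, rfl⟩
    rw [SetLike.mem_coe, HodgeStructure.mem_complexConj, HodgeStructure.conj_conj]
    exact Submodule.subset_span hx

/-- the Hodge filtration of the toy model on `ℂ ⊗ ⋀^k L X` -/
def hodgeF (k : ℕ) (p : ℤ) : Submodule ℂ (ℂ ⊗[ℚ] ↥(⋀[ℚ]^k X.L)) := (X.FF k p).comap (X.Θ k).toLinearMap

/-- (Ported verbatim from the HodgeCMPerL package; no docstring in the source.) -/
lemma hodgeF_eq_map (k : ℕ) (p : ℤ) : X.hodgeF k p = (X.FF k p).map (X.Θ k).symm.toLinearMap := by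
  rw [hodgeF, Submodule.comap_equiv_eq_map_symm]

/-- (Ported verbatim from the HodgeCMPerL package; no docstring in the source.) -/
lemma mem_hodgeF {k : ℕ} {p : ℤ} {x : ℂ ⊗[ℚ] ↥(⋀[ℚ]^k X.L)} : x ∈ X.hodgeF k p ↔ X.Θ k x ∈ X.FF k p :=
  Iff.rfl

/-- **Conjugate filtration**: `conj F^q = Θ⁻¹ GG p` for `p + q = k + 1`. -/
theorem complexConj_hodgeF (k : ℕ) (p q : ℤ) (hpq : p + q = k + 1) :
    HodgeStructure.complexConj (X.hodgeF k q) = (X.GG k p).comap (X.Θ k).toLinearMap := by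
  rw [hodgeF_eq_map, Submodule.comap_equiv_eq_map_symm, FF, GG, Submodule.map_span, Submodule.map_span,
    complexConj_span]
  congr 1
  ext x
  constructor
  · rintro ⟨_, ⟨_, ⟨g, hg, rfl⟩, rfl⟩, rfl⟩
    refine ⟨X.mono k (X.bar ∘ g), ⟨X.bar ∘ g, ?_, rfl⟩, ?_⟩
    · have := X.cnt_bar g; omega
    · exact (X.conj_theta_symm_mono k g).symm
  · rintro ⟨_, ⟨h, hh, rfl⟩, rfl⟩
    refine ⟨(X.Θ k).symm (X.mono k (X.bar ∘ h)), ⟨_, ⟨X.bar ∘ h, ?_, rfl⟩, rfl⟩, ?_⟩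
    · have := X.cnt_bar h; omega
    · change HodgeStructure.conj ((X.Θ k).symm (X.mono k (X.bar ∘ h))) = (X.Θ k).symm (X.mono k h)
      rw [conj_theta_symm_mono]
      congr 2
      funext j
      simp

/-- **Opposedness** of the toy Hodge filtration. -/
theorem isCompl_hodgeF (k : ℕ) (p q : ℤ) (hpq : p + q = k + 1) :
    IsCompl (X.hodgeF k p) (HodgeStructure.complexConj (X.hodgeF k q)) := by
  rw [complexConj_hodgeF X k p q hpq, hodgeF, Submodule.comap_equiv_eq_map_symm,
    Submodule.comap_equiv_eq_map_symm]
  exact (Submodule.orderIsoMapComap (X.Θ k).symm).isCompl (X.isCompl_FF_GG k p)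

/-- (Ported verbatim from the HodgeCMPerL package; no docstring in the source.) -/
lemma hodgeF_antitone (k : ℕ) : Antitone (X.hodgeF k) := fun _ _ h =>
  Submodule.comap_mono (X.FF_antitone k h)

/-- (Ported verbatim from the HodgeCMPerL package; no docstring in the source.) -/
lemma hodgeF_eq_top {k : ℕ} {p : ℤ} (hp : p ≤ 0) : X.hodgeF k p = ⊤ := by
  rw [hodgeF, X.FF_eq_top hp, Submodule.comap_top]

/-- (Ported verbatim from the HodgeCMPerL package; no docstring in the source.) -/
lemma hodgeF_eq_bot {k : ℕ} {p : ℤ} (hp : (k : ℤ) < p) : X.hodgeF k p = ⊥ := by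
  rw [hodgeF, X.FF_eq_bot hp, Submodule.comap_bot]
  exact LinearEquiv.ker _

/-- **The toy Hodge structure** of weight `k` on `⋀^k L X`. -/
def hodgeStructure (k : ℕ) : HodgeStructure (↥(⋀[ℚ]^k X.L)) (k : ℤ) where
  F := X.hodgeF k
  antitone_F := X.hodgeF_antitone k
  exists_F_eq_top := ⟨0, X.hodgeF_eq_top le_rfl⟩
  exists_F_eq_bot := ⟨k + 1, X.hodgeF_eq_bot (by omega)⟩
  isCompl_F_complexConj := fun p q h => X.isCompl_hodgeF k p q h

end Obj

end

end HodgeCM.Toy
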